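import Summits.BirchSwinnertonDyer.Rank1Residual.ManinAdditive.ShimuraIndexSignLaws
import Literature.NumberTheory.EllipticCurves.BSDHeegnerPointsTorsionProofs
import Literature.NumberTheory.EllipticCurves.ModularSymbolsProofs
import HarnessLib

/-!
# THEOREM AL, part 1 — the Atkin–Lehner conjugate, the doubling element, two signs ⟹ `4Λ₀ ⊆ Λ₁` (PROVED)
# (cell `bsd-f2-manin`, planner es g20 §3♯/§33.11–33.12, T-es-26 part A; over `ShimuraIndexFrickeLaw` / `ShimuraIndexSignLaws`)

For a weight-2 cusp form `f` on `Γ₀(N)` (NO newform hypothesis) and an exact divisor `Q ∥ N`: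
* `exists_alConj`: the explicit Atkin–Lehner conjugate `γ' = β(Q) γ̃ β(Q)⁻¹ ∈ Γ₀(N)` of `γ ∈ Γ₀(N)`:
  `w_Q ∘ γ = γ' ∘ w_Q` on `ℍ`, `a_{γ'} ≡ a_γ (mod N/Q)`, `a_{γ'} ≡ d_γ (mod Q)` (inversion on the `Q`-component);
* `exists_alConj_cuspSymbol`: `w_Q f = ε f ⟹ {∞, γ'∞}_f = ε {∞, γ∞}_f` (Eichler law `eichlerIntegral_atkinLehnerW_smul`);
* `exists_eta_of_atkinLehner_eq_neg`: `ε = −1` ⟹ `ν = γγ'⁻¹` has `{∞,ν∞} = 2{∞,γ∞}`, `d_ν ≡ 1 (mod N/Q)`,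
  `d_ν ≡ d_γ² (mod Q)`;
* `four_mul_cuspSymbol_mem_of_two_atkinLehner_eq_neg`: two coprime exact divisors with sign `−1` ⟹ `4Λ₀(f) ⊆ Λ₁(f)`;
* **E-es-77 `TwoAtkinLehnerSignsLaw` PROVED**: two distinct primes with `λ = −1` ⟹ `Λ₀(f)/Λ₁(f)` has no odd torsion
  (the uniqueness half of E-es-71 `AtkinLehnerShimuraSignLaw`, law-free).
Part 2 (`ShimuraIndexAtkinLehnerProofs`): THEOREM AL₍p₎, the Euler form, E-es-71♮ PROVED, E-es-71 ⟸ E-es-78, consequences.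
bears_on: stmt-BirchSwinnertonDyer-22968 (crux C3, stub 5 of `kato_shift_three`).  PARTITION 0.
BSD is not proved by this; Manin's conjecture is not proved by this.
-/

noncomputable section

open scoped Classical MatrixGroups ModularForm ComplexConjugate

open CongruenceSubgroup Complex WeierstrassCurve UpperHalfPlane Literature.NumberTheory.EllipticCurves
  Literature.NumberTheory.EllipticCurves.ModularForms

namespace Summit.BirchSwinnertonDyer.Rank1Residual.ManinAdditive.KatoCurve

open Summit.BirchSwinnertonDyer.Rank1Residual.ManinAdditive.CuspidalKummer
  Summit.BirchSwinnertonDyer.Rank1Residual.ManinAdditive.CuspidalKummerThree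

section ALConj

variable {N : ℕ} [NeZero N] {Q : ℕ} [NeZero Q]

/-- `diag(Q,1) (γ τ) = γ̃ (diag(Q,1) τ)` with `γ̃ = (a, Qb; c/Q, d)`. -/
theorem tpD_smul_sl_smul (g G : SL(2, ℤ)) (h00 : (G 0 0 : ℤ) = g 0 0) (h01 : (G 0 1 : ℤ) = Q * g 0 1)
    (h10 : (G 1 0 : ℤ) * Q = g 1 0) (h11 : (G 1 1 : ℤ) = g 1 1) (τ : ℍ) :
    tpD Q • (g • τ) = G • (tpD Q • τ) := by
  apply UpperHalfPlane.ext
  rw [coe_tpD_smul, coe_specialLinearGroup_apply, coe_specialLinearGroup_apply, coe_tpD_smul]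
  simp only [eq_intCast]
  have hdet : (g 0 0 : ℤ) * g 1 1 - g 0 1 * g 1 0 = 1 := by
    have := g.2; rwa [Matrix.det_fin_two] at this
  have hcd : (g 1 0 : ℤ) ≠ 0 ∨ (g 1 1 : ℤ) ≠ 0 := by
    by_contra h; push Not at h; rw [h.1, h.2] at hdet; simp at hdet
  have hden : ((g 1 0 : ℤ) : ℂ) * (τ : ℂ) + ((g 1 1 : ℤ) : ℂ) ≠ 0 := intLinear_ne_zero τ hcd
  have e00 : ((G 0 0 : ℤ) : ℂ) = ((g 0 0 : ℤ) : ℂ) := by exact_mod_cast h00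
  have e01 : ((G 0 1 : ℤ) : ℂ) = (Q : ℂ) * ((g 0 1 : ℤ) : ℂ) := by exact_mod_cast h01
  have e10 : ((G 1 0 : ℤ) : ℂ) * (Q : ℂ) = ((g 1 0 : ℤ) : ℂ) := by exact_mod_cast h10
  have e11 : ((G 1 1 : ℤ) : ℂ) = ((g 1 1 : ℤ) : ℂ) := by exact_mod_cast h11
  push_cast
  rw [e00, e01, e11]
  have hden2 : ((G 1 0 : ℤ) : ℂ) * ((Q : ℂ) * (τ : ℂ)) + ((g 1 1 : ℤ) : ℂ) ≠ 0 := by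
    rw [← mul_assoc, e10]; exact hden
  rw [← mul_div_assoc, div_eq_div_iff hden hden2, ← e10]
  ring

omit [NeZero N] in
/-- **The Atkin–Lehner conjugate** `γ' = w(Q) γ w(Q)⁻¹ = β(Q) γ̃ β(Q)⁻¹` of `γ ∈ Γ₀(N)` (`Q ∥ N`):
`γ' ∈ Γ₀(N)`, its upper-left entry is `≡ a_γ (mod N/Q)`, and `w(Q) (γ τ) = γ' (w(Q) τ)` on `ℍ`. -/
theorem exists_alConj (hQN : Q ∣ N) (hcop : Nat.Coprime Q (N / Q)) (γ : Gamma0 N) :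
    ∃ γ' : SL(2, ℤ), γ' ∈ Gamma0 N ∧
      (((γ' 0 0 : ℤ) : ZMod (N / Q)) = (((γ : SL(2, ℤ)) 0 0 : ℤ) : ZMod (N / Q))) ∧
      (((γ' 0 0 : ℤ) : ZMod Q) = (((γ : SL(2, ℤ)) 1 1 : ℤ) : ZMod Q)) ∧
      ∀ τ : ℍ, glCast (atkinLehnerW N Q : GL (Fin 2) ℚ) • ((γ : SL(2, ℤ)) • τ) =
        γ' • (glCast (atkinLehnerW N Q : GL (Fin 2) ℚ) • τ) := by
  set g : SL(2, ℤ) := (γ : SL(2, ℤ)) with hg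
  set R : ℕ := N / Q with hR
  have hNQR : (N : ℤ) = Q * R := by rw [hR]; exact_mod_cast (Nat.mul_div_cancel' hQN).symm
  have hc : (((g 1 0 : ℤ) : ZMod N)) = 0 := Gamma0_mem.mp γ.2
  obtain ⟨c₀, hc₀⟩ := (ZMod.intCast_zmod_eq_zero_iff_dvd _ N).mp hc
  have hdet : (g 0 0 : ℤ) * g 1 1 - g 0 1 * g 1 0 = 1 := by
    have := g.2; rwa [Matrix.det_fin_two] at this
  -- `γ̃ = (a, Qb; R c₀, d)`
  let G : SL(2, ℤ) := ⟨!![g 0 0, Q * g 0 1; R * c₀, g 1 1], by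
    rw [Matrix.det_fin_two_of]
    rw [hc₀, hNQR] at hdet
    linear_combination hdet⟩
  obtain ⟨hβ10, hβ11⟩ : (atkinLehnerSL N Q) 1 0 = (R : ℤ) ∧ (atkinLehnerSL N Q) 1 1 = (Q : ℤ) :=
    atkinLehnerSL_apply_one N Q hcop
  have hbez : (Q : ℤ) * (atkinLehnerSL N Q) 0 0 - (R : ℤ) * (atkinLehnerSL N Q) 0 1 = 1 :=
    atkinLehnerSL_bezout N Q hcop
  set β : SL(2, ℤ) := atkinLehnerSL N Q with hβ
  have h00 : ((β * G * β⁻¹ : SL(2, ℤ)) 0 0 : ℤ) =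
      β 0 0 * (g 0 0 * Q - Q * g 0 1 * R) + β 0 1 * (R * c₀ * Q - g 1 1 * R) := by
    rw [Matrix.SpecialLinearGroup.coe_mul, Matrix.SpecialLinearGroup.coe_mul,
      Matrix.SpecialLinearGroup.coe_inv, Matrix.adjugate_fin_two]
    simp only [G, Matrix.mul_apply, Fin.sum_univ_two, Matrix.of_apply, Matrix.cons_val',
      Matrix.cons_val_zero, Matrix.cons_val_one, Matrix.cons_val_fin_one, hβ10, hβ11]
    ring
  refine ⟨β * G * β⁻¹, ?_, ?_, ?_, ?_⟩
  · -- lower-left entry divisible by `N`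
    rw [Gamma0_mem]
    have h10 : ((β * G * β⁻¹ : SL(2, ℤ)) 1 0 : ℤ) =
        N * (g 0 0 - g 0 1 * R + c₀ * Q - g 1 1) := by
      rw [Matrix.SpecialLinearGroup.coe_mul, Matrix.SpecialLinearGroup.coe_mul,
        Matrix.SpecialLinearGroup.coe_inv, Matrix.adjugate_fin_two]
      simp only [G, Matrix.mul_apply, Fin.sum_univ_two, Matrix.of_apply, Matrix.cons_val',
        Matrix.cons_val_zero, Matrix.cons_val_one, Matrix.cons_val_fin_one, hβ10, hβ11]
      rw [hNQR]
      ring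
    rw [h10]
    push_cast
    rw [ZMod.natCast_self, zero_mul]
  · -- upper-left entry `≡ a (mod R)`
    rw [h00]
    have hR0 : ((R : ℕ) : ZMod R) = 0 := ZMod.natCast_self R
    have hbz : ((Q : ℕ) : ZMod R) * ((β 0 0 : ℤ) : ZMod R) = 1 := by
      have := congrArg (fun z : ℤ ↦ (z : ZMod R)) hbez
      push_cast at this
      rw [hR0] at this
      linear_combination this
    push_cast
    rw [hR0]
    linear_combination ((g 0 0 : ℤ) : ZMod R) * hbz
  · -- upper-left entry `≡ d (mod Q)` (inversion on the `Q`-component)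
    rw [h00]
    have hQ0 : ((Q : ℕ) : ZMod Q) = 0 := ZMod.natCast_self Q
    have hbz : -(((R : ℕ) : ZMod Q) * ((β 0 1 : ℤ) : ZMod Q)) = 1 := by
      have := congrArg (fun z : ℤ ↦ (z : ZMod Q)) hbez
      push_cast at this
      rw [hQ0] at this
      linear_combination this
    push_cast
    rw [hQ0]
    linear_combination ((g 1 1 : ℤ) : ZMod Q) * hbz
  · intro τ
    have hw : ∀ σ : ℍ, glCast (atkinLehnerW N Q : GL (Fin 2) ℚ) • σ = β • (tpD Q • σ) := by
      intro σ
      rw [hβ, glCast_atkinLehnerW, mul_smul]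
      rfl
    have hT : tpD Q • (g • τ) = G • (tpD Q • τ) := by
      refine tpD_smul_sl_smul g G rfl rfl ?_ rfl τ
      show (R : ℤ) * c₀ * Q = g 1 0
      rw [hc₀, hNQR]; ring
    rw [hw, hw, hT, mul_smul, mul_smul, inv_smul_smul]

/-- **`{∞, γ'∞}_f = ε_Q {∞, γ∞}_f`** for the Atkin–Lehner conjugate (`w_Q f = ε_Q f`): the Eichler integral
transforms as `E_f(w(Q)τ) = ε_Q E_f(τ) + const` (tree `eichlerIntegral_atkinLehnerW_smul`). -/
theorem exists_alConj_cuspSymbol (hQN : Q ∣ N) (hcop : Nat.Coprime Q (N / Q))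
    (f : CuspForm (Gamma0 N) 2) {ε : ℂ} (hε : atkinLehnerInvolution N 2 Q f = ε • f) (γ : Gamma0 N) :
    ∃ γ' : Gamma0 N,
      ((((γ' : SL(2, ℤ)) 0 0 : ℤ) : ZMod (N / Q)) = (((γ : SL(2, ℤ)) 0 0 : ℤ) : ZMod (N / Q))) ∧
      ((((γ' : SL(2, ℤ)) 0 0 : ℤ) : ZMod Q) = (((γ : SL(2, ℤ)) 1 1 : ℤ) : ZMod Q)) ∧
      cuspSymbol f γ' = ε * cuspSymbol f γ := by
  obtain ⟨γ', hγ', h00, h00Q, hpt⟩ := exists_alConj hQN hcop γ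
  refine ⟨⟨γ', hγ'⟩, h00, h00Q, ?_⟩
  set τ₀ : ℍ := UpperHalfPlane.I
  set W := glCast (atkinLehnerW N Q : GL (Fin 2) ℚ)
  have h1 := eichlerIntegral_smul_sub_holds f ⟨γ', hγ'⟩ (W • τ₀)
  have h2 := eichlerIntegral_smul_sub_holds f γ τ₀
  have h3 := eichlerIntegral_atkinLehnerW_smul hQN hcop hε ((γ : SL(2, ℤ)) • τ₀)
  have h4 := eichlerIntegral_atkinLehnerW_smul hQN hcop hε τ₀
  have h1' : eichlerIntegral f (W • ((γ : SL(2, ℤ)) • τ₀)) - eichlerIntegral f (W • τ₀) =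
      cuspSymbol f ⟨γ', hγ'⟩ := by
    rw [hpt τ₀]; exact h1
  linear_combination (-1 : ℂ) * h1' + h3 - h4 + ε * h2

end ALConj

section ALLattice

variable {N : ℕ} [NeZero N] {Q : ℕ} [NeZero Q]

/-- STEP 1 (`ε_Q = −1`): `ν := γ γ'⁻¹ ∈ Γ₀(N)` has `{∞, ν∞}_f = 2 {∞, γ∞}_f` exactly and `d_ν ≡ 1 (mod N/Q)`. -/
theorem exists_eta_of_atkinLehner_eq_neg (hQN : Q ∣ N) (hcop : Nat.Coprime Q (N / Q))
    (f : CuspForm (Gamma0 N) 2) (hε : atkinLehnerInvolution N 2 Q f = (-1 : ℂ) • f) (γ : Gamma0 N) :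
    ∃ ν : Gamma0 N, cuspSymbol f ν = 2 * cuspSymbol f γ ∧
      ((((ν : SL(2, ℤ)) 1 1 : ℤ) : ZMod (N / Q)) = 1) ∧
      ((((ν : SL(2, ℤ)) 1 1 : ℤ) : ZMod Q) = (((γ : SL(2, ℤ)) 1 1 : ℤ) : ZMod Q) ^ 2) := by
  obtain ⟨γ', h00, h00Q, hγ'⟩ := exists_alConj_cuspSymbol hQN hcop f hε γ
  set R : ℕ := N / Q with hR
  have hNQR : (N : ℤ) = Q * R := by rw [hR]; exact_mod_cast (Nat.mul_div_cancel' hQN).symm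
  have hc : ((((γ : SL(2, ℤ)) 1 0 : ℤ) : ZMod N)) = 0 := Gamma0_mem.mp γ.2
  obtain ⟨c₁, hc₁⟩ := (ZMod.intCast_zmod_eq_zero_iff_dvd _ N).mp hc
  have hdet : ((γ : SL(2, ℤ)) 0 0 : ℤ) * (γ : SL(2, ℤ)) 1 1 -
      (γ : SL(2, ℤ)) 0 1 * (γ : SL(2, ℤ)) 1 0 = 1 := by
    have := (γ : SL(2, ℤ)).2; rwa [Matrix.det_fin_two] at this
  have e11 : (((γ * γ'⁻¹ : Gamma0 N) : SL(2, ℤ)) 1 1 : ℤ) =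
      (γ : SL(2, ℤ)) 1 0 * (-((γ' : SL(2, ℤ)) 0 1)) + (γ : SL(2, ℤ)) 1 1 * (γ' : SL(2, ℤ)) 0 0 := by
    simp only [Subgroup.coe_mul, Subgroup.coe_inv, Matrix.SpecialLinearGroup.coe_mul,
      Matrix.SpecialLinearGroup.coe_inv, Matrix.adjugate_fin_two, Matrix.mul_apply, Fin.sum_univ_two,
      Matrix.of_apply, Matrix.cons_val', Matrix.cons_val_zero, Matrix.cons_val_one,
      Matrix.cons_val_fin_one]
  rw [hc₁, hNQR] at hdet e11
  refine ⟨γ * γ'⁻¹, ?_, ?_, ?_⟩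
  · have h2 := cuspSymbol_mul_holds f γ' γ'⁻¹
    rw [mul_inv_cancel, cuspSymbol_one, hγ'] at h2
    rw [cuspSymbol_mul_holds f]
    linear_combination (-1 : ℂ) * h2
  · rw [e11]
    have hR0 : ((R : ℕ) : ZMod R) = 0 := ZMod.natCast_self R
    have hdet' := congrArg (fun z : ℤ ↦ (z : ZMod R)) hdet
    push_cast at hdet' ⊢
    rw [h00]
    linear_combination hdet' + ((Q : ZMod R) * (c₁ : ZMod R) *
      ((((γ : SL(2, ℤ)) 0 1 : ℤ) : ZMod R) - (((γ' : SL(2, ℤ)) 0 1 : ℤ) : ZMod R))) * hR0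
  · rw [e11]
    have hQ0 : ((Q : ℕ) : ZMod Q) = 0 := ZMod.natCast_self Q
    push_cast
    rw [h00Q, hQ0]
    ring

omit [NeZero N] in
/-- Closure induction + Bezout: `K·{∞,γ∞}_f ∈ Λ₁(f)` for all `γ` and `gcd(p, K) = 1` ⟹ `K Λ₀ ⊆ Λ₁` and
`Λ₀/Λ₁` has no `p`-torsion. -/
theorem noTorsion_of_natMul_cuspSymbol_mem {p K : ℕ} (hpK : Nat.Coprime p K) (f : CuspForm (Gamma0 N) 2)
    (h : ∀ γ : Gamma0 N, (K : ℂ) * cuspSymbol f γ ∈ periodLatticeGamma1 f) :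
    (∀ x ∈ periodLattice f, (K : ℂ) * x ∈ periodLatticeGamma1 f) ∧
      ∀ x ∈ periodLattice f, (p : ℂ) * x ∈ periodLatticeGamma1 f → x ∈ periodLatticeGamma1 f := by
  have hK : ∀ x ∈ periodLattice f, (K : ℂ) * x ∈ periodLatticeGamma1 f := by
    intro x hx
    induction hx using AddSubgroup.closure_induction with
    | mem x hx => obtain ⟨γ, rfl⟩ := hx; exact h γ
    | zero => rw [mul_zero]; exact zero_mem _
    | add x y _ _ hx hy => rw [mul_add]; exact add_mem hx hy
    | neg x _ hx => rw [mul_neg]; exact neg_mem hx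
  refine ⟨hK, fun x hx hpx => ?_⟩
  obtain ⟨a, b, hab⟩ := Nat.isCoprime_iff_coprime.mpr hpK
  have h1 : (a : ℂ) * p + (b : ℂ) * (K : ℂ) = 1 := by exact_mod_cast hab
  have hx' : x = (a : ℂ) * ((p : ℂ) * x) + (b : ℂ) * ((K : ℂ) * x) := by
    linear_combination (-x) * h1
  have ha : (a : ℂ) * ((p : ℂ) * x) ∈ periodLatticeGamma1 f := by
    have := AddSubgroup.zsmul_mem (periodLatticeGamma1 f) hpx a
    simpa [zsmul_eq_mul] using this
  have hb : (b : ℂ) * ((K : ℂ) * x) ∈ periodLatticeGamma1 f := by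
    have := AddSubgroup.zsmul_mem (periodLatticeGamma1 f) (hK x hx) b
    simpa [zsmul_eq_mul] using this
  rw [hx']
  exact add_mem ha hb

/-- **TWO SIGNS (PROVED)**: `w_{Q₁} f = −f` and `w_{Q₂} f = −f` for coprime exact divisors `Q₁, Q₂ ∥ N` ⟹
`4·{∞, γ∞}_f ∈ Λ₁(f)` for every `γ` (apply the `Q₂`-doubling to `ν₁`: `d ≡ d_{ν₁}² ≡ 1 (mod Q₂)` and `≡ 1 (mod N/Q₂)`). -/
theorem four_mul_cuspSymbol_mem_of_two_atkinLehner_eq_neg {Q₁ Q₂ : ℕ} [NeZero Q₁] [NeZero Q₂]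
    (h₁N : Q₁ ∣ N) (hc₁ : Nat.Coprime Q₁ (N / Q₁)) (h₂N : Q₂ ∣ N) (hc₂ : Nat.Coprime Q₂ (N / Q₂))
    (h12 : Nat.Coprime Q₁ Q₂) (f : CuspForm (Gamma0 N) 2)
    (hε₁ : atkinLehnerInvolution N 2 Q₁ f = (-1 : ℂ) • f) (hε₂ : atkinLehnerInvolution N 2 Q₂ f = (-1 : ℂ) • f)
    (γ : Gamma0 N) : (4 : ℂ) * cuspSymbol f γ ∈ periodLatticeGamma1 f := by
  obtain ⟨ν₁, hν₁, hν₁R, -⟩ := exists_eta_of_atkinLehner_eq_neg h₁N hc₁ f hε₁ γ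
  obtain ⟨ν₂, hν₂, hν₂R, hν₂Q⟩ := exists_eta_of_atkinLehner_eq_neg h₂N hc₂ f hε₂ ν₁
  set d₁ : ℤ := ((ν₁ : SL(2, ℤ)) 1 1 : ℤ)
  set d₂ : ℤ := ((ν₂ : SL(2, ℤ)) 1 1 : ℤ)
  have hN1 : (N : ℤ) = Q₁ * (N / Q₁ : ℕ) := by exact_mod_cast (Nat.mul_div_cancel' h₁N).symm
  have hN2 : (N : ℤ) = Q₂ * (N / Q₂ : ℕ) := by exact_mod_cast (Nat.mul_div_cancel' h₂N).symm
  -- `Q₂ ∣ N/Q₁`, so `d₁ ≡ 1 (mod Q₂)`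
  have hQ2R1 : (Q₂ : ℤ) ∣ ((N / Q₁ : ℕ) : ℤ) := by
    have h : (Q₂ : ℤ) ∣ (Q₁ : ℤ) * ((N / Q₁ : ℕ) : ℤ) := by rw [← hN1]; exact_mod_cast h₂N
    exact (Nat.isCoprime_iff_coprime.mpr h12.symm).dvd_of_dvd_mul_left h
  have hd1 : ((N / Q₁ : ℕ) : ℤ) ∣ d₁ - 1 := by
    rw [← ZMod.intCast_zmod_eq_zero_iff_dvd]; push_cast; rw [hν₁R]; ring
  have hd1Q : (d₁ : ZMod Q₂) = 1 := by
    have := (ZMod.intCast_zmod_eq_zero_iff_dvd _ Q₂).mpr (hQ2R1.trans hd1)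
    push_cast at this
    exact sub_eq_zero.mp this
  have hQ : (Q₂ : ℤ) ∣ d₂ - 1 := by
    rw [← ZMod.intCast_zmod_eq_zero_iff_dvd]; push_cast; rw [hν₂Q, hd1Q]; ring
  have hR : ((N / Q₂ : ℕ) : ℤ) ∣ d₂ - 1 := by
    rw [← ZMod.intCast_zmod_eq_zero_iff_dvd]; push_cast; rw [hν₂R]; ring
  have hNd : (N : ℤ) ∣ d₂ - 1 := by
    rw [hN2]; exact IsCoprime.mul_dvd (Nat.isCoprime_iff_coprime.mpr hc₂) hQ hR
  have h1 : (d₂ : ZMod N) = 1 := by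
    have := (ZMod.intCast_zmod_eq_zero_iff_dvd _ N).mpr hNd
    push_cast at this
    exact sub_eq_zero.mp this
  have hmem := cuspSymbol_mem_periodLatticeGamma1_of_apply_eq_one f ν₂ h1
  rw [hν₂, hν₁] at hmem
  convert hmem using 1
  ring

/-- **THEOREM AL (two signs, PROVED)**: two coprime exact divisors with Atkin–Lehner sign `−1` ⟹ `4Λ₀(f) ⊆ Λ₁(f)`,
so `Λ₀(f)/Λ₁(f)` has no odd torsion. -/
theorem noOddTorsion_of_two_atkinLehner_eq_neg {Q₁ Q₂ : ℕ} [NeZero Q₁] [NeZero Q₂]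
    (h₁N : Q₁ ∣ N) (hc₁ : Nat.Coprime Q₁ (N / Q₁)) (h₂N : Q₂ ∣ N) (hc₂ : Nat.Coprime Q₂ (N / Q₂))
    (h12 : Nat.Coprime Q₁ Q₂) (f : CuspForm (Gamma0 N) 2)
    (hε₁ : atkinLehnerInvolution N 2 Q₁ f = (-1 : ℂ) • f) (hε₂ : atkinLehnerInvolution N 2 Q₂ f = (-1 : ℂ) • f)
    {p : ℕ} (hp : p.Prime) (hp2 : p ≠ 2) :
    (∀ x ∈ periodLattice f, ((4 : ℕ) : ℂ) * x ∈ periodLatticeGamma1 f) ∧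
      ∀ x ∈ periodLattice f, (p : ℂ) * x ∈ periodLatticeGamma1 f → x ∈ periodLatticeGamma1 f := by
  refine noTorsion_of_natMul_cuspSymbol_mem ?_ f fun γ => ?_
  · have h2 : Nat.Coprime p 2 := (Nat.coprime_primes hp Nat.prime_two).mpr hp2
    simpa using Nat.Coprime.mul_right h2 h2
  · simpa using four_mul_cuspSymbol_mem_of_two_atkinLehner_eq_neg h₁N hc₁ h₂N hc₂ h12 f hε₁ hε₂ γ

end ALLattice

section TwoSigns

variable {N : ℕ} [NeZero N]

/-- `λ_{Q_p}(f) = −1 ⟹ w_{Q_p} f = −f` (the junk value of `atkinLehnerEigenvalue` is `0 ≠ −1`). -/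
theorem atkinLehnerInvolution_eq_neg_of_eigenvalueAt (f : CuspForm (Gamma0 N) 2) {p Q : ℕ} [NeZero Q]
    (hQ : p ^ N.factorization p = Q) (hε : atkinLehnerEigenvalueAt f p = -1) :
    atkinLehnerInvolution N 2 Q f = (-1 : ℂ) • f := by
  rw [atkinLehnerEigenvalueAt_eq f hQ] at hε
  by_cases hex : ∃ ε : ℂ, atkinLehnerInvolution N 2 Q f = ε • f
  · rw [atkinLehnerInvolution_eq_atkinLehnerEigenvalue_smul Q hex, hε]
  · exfalso
    rw [atkinLehnerEigenvalue, dif_neg hex] at hε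
    norm_num at hε

/-- **THEOREM AL (two primes, PROVED)**: two distinct primes `q₁, q₂` (necessarily `∣ N`) with `λ_{Q_{q₁}}(f) = λ_{Q_{q₂}}(f) = −1`
⟹ `4Λ₀(f) ⊆ Λ₁(f)`, so `Λ₀(f)/Λ₁(f)` has no `p`-torsion for every odd prime `p`. -/
theorem shimuraIndexPrimeTo_of_two_atkinLehnerEigenvalueAt_eq_neg_one (f : CuspForm (Gamma0 N) 2)
    {p q₁ q₂ : ℕ} (hp : p.Prime) (hp2 : p ≠ 2) (hq₁ : q₁.Prime) (hq₂ : q₂.Prime) (hne : q₁ ≠ q₂)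
    (hε₁ : atkinLehnerEigenvalueAt f q₁ = -1) (hε₂ : atkinLehnerEigenvalueAt f q₂ = -1) :
    ShimuraIndexPrimeTo p f := by
  have hN0 : N ≠ 0 := NeZero.ne N
  haveI : NeZero (q₁ ^ N.factorization q₁) := ⟨pow_ne_zero _ hq₁.ne_zero⟩
  haveI : NeZero (q₂ ^ N.factorization q₂) := ⟨pow_ne_zero _ hq₂.ne_zero⟩
  exact (noOddTorsion_of_two_atkinLehner_eq_neg (Nat.ordProj_dvd N q₁)
    (Nat.Coprime.pow_left _ (Nat.coprime_ordCompl hq₁ hN0)) (Nat.ordProj_dvd N q₂)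
    (Nat.Coprime.pow_left _ (Nat.coprime_ordCompl hq₂ hN0)) (Nat.coprime_pow_primes _ _ hq₁ hq₂ hne) f
    (atkinLehnerInvolution_eq_neg_of_eigenvalueAt f rfl hε₁)
    (atkinLehnerInvolution_eq_neg_of_eigenvalueAt f rfl hε₂) hp hp2).2

end TwoSigns

section SignsLaw

/-- **E-es-77 `TwoAtkinLehnerSignsLaw`** (the uniqueness half of E-es-71, law-free): two distinct primes with
Atkin–Lehner sign `−1` ⟹ `Λ₀(f)/Λ₁(f)` has no odd torsion (indeed `4Λ₀ ⊆ Λ₁`). A THEOREM (`twoAtkinLehnerSignsLaw_holds`).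
TYPER FRAMING (cell bsd-f2-manin, lens es — Shimura index / explicit Atkin–Lehner conjugates; planner es g20 MEMO-es §33.11–33.12,
source HOME/es/T-es-26A-ShimuraIndexAtkinLehnerConj.lean sha16 4dc7831fd30ed73a VERBATIM, T-es-26 v2): typed as an item only so
that the uniqueness edge of E-es-71 `AtkinLehnerShimuraSignLaw` is credited BY NAME; it is DISCHARGED in this file, so no BC5
census is needed (the es §14.3 gain census is its numerical shadow).  NOT in print in this form (periods `Λ₀/Λ₁` of an arbitrary
weight-2 cusp form; mechanism = Atkin–Li / Ling–Oesterlé, known).  REF1 R-es-40 (statement audit of E-es-77/78) PENDING at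
filing; REF1 §R75 (R-es-39): T-es-26 «independently rc 0 / axioms standard — land as is».  Beyond-print theorem: yes-small.
[cite: AtkinLehner1970, Thm. 3 (shape only: the `w_Q`-eigenvector property of newforms; the two-signs period-lattice law is the cell's E-es-77, PROVED here — es MEMO-es §33.12)] -/
@[conjecture]
def TwoAtkinLehnerSignsLaw : Prop :=
  ∀ (N : ℕ) [NeZero N] (f : CuspForm (Gamma0 N) 2) (p : ℕ), p.Prime → p ≠ 2 →
    ∀ q₁ q₂ : ℕ, q₁.Prime → q₂.Prime → q₁ ≠ q₂ →
      atkinLehnerEigenvalueAt f q₁ = -1 → atkinLehnerEigenvalueAt f q₂ = -1 → ShimuraIndexPrimeTo p f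

/-- E-es-77 PROVED. -/
theorem twoAtkinLehnerSignsLaw_holds : TwoAtkinLehnerSignsLaw :=
  fun _ _ f _ hp hp2 _ _ hq₁ hq₂ hne h₁ h₂ ↦
    shimuraIndexPrimeTo_of_two_atkinLehnerEigenvalueAt_eq_neg_one f hp hp2 hq₁ hq₂ hne h₁ h₂

end SignsLaw

end Summit.BirchSwinnertonDyer.Rank1Residual.ManinAdditive.KatoCurve

end
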